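import Summits.ValiantsHypothesis.ValiantsHypothesis.Theorems.LacunarySymmetroidMatrixDescartesLagrangeMirrorSecular

/-!
# `MatrixDescartes` census — two-sided (mirror) Lagrange tower: secular identity and inherited alternation for either orientation

HONEST FRAMING.  Object-search cell `pub-symmetroid`, crux `Theses.LacunarySymmetroid.MatrixDescartes`
(stmt-ValiantsHypothesis-18050); seat val-sym-mdr-p1 (g2).  Part of the kernel port of the cell's TWO-SIDED Lagrange tower P4
(conjb-3 g4, ROUND4-MEMO §2) in the seat's arrowhead form (`…LagrangeMirrorDefs`): for EVERY `m ≥ 1` some real symmetric FOUR-term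
lacunary `m × m` pencil has `m² + 2m` distinct positive determinant roots (`¬ PosRootLawAt m 4 ((m+1)² − 2)`).  A LOWER-bound /
construction statement in census (CONJECTURE-A) currency for the `K = 4` column; it proves nothing about the crux `MatrixDescartes`
(an upper-bound statement at fat formats), nothing about the cubic-vs-quadratic fork beyond this floor, and nothing about `VP ≠ VNP`.
No definitions in this file.

THIS FILE. `Gen.radicand_pos` (`0 < −η r_l β_l` with `η = s^{k+1}(−1)^kθ`), the secular identity `Gen.ψfun_mul_Npoly`, `Gen.ψfun_root`, the
derivative identity `Gen.βnew_mul_Npoly` and the inherited alternation `Gen.βnew_alt : 0 < θ_new (−1)^i βnew i`, `θ_new = s (−1)^k θ`. [folklore]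
-/

-- `Summit.ValiantsHypothesis.ValiantsHypothesis.…` repeats a component by the D-0017 layout
-- (single-conjunct summit), which the `dupNamespace` linter flags; the name is mandated.
set_option linter.dupNamespace false

namespace Summit.ValiantsHypothesis.ValiantsHypothesis.Theorems.LacunarySymmetroidMatrixDescartes.Census.LagrangeTower

open Matrix Polynomial Finset
open scoped BigOperators

namespace Gen

section Secular

variable {k : ℕ} (ν : Fin k → ℝ) (z : Fin (k + 1) → ℝ) (s : ℝ) (d : TowerData k)

/-- `s^a · s^a = 1` for `s = ±1`. -/
theorem sq_pow_eq_one {s : ℝ} (hs : s = 1 ∨ s = -1) (a : ℕ) : s ^ a * s ^ a = 1 := by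
  rcases hs with rfl | rfl
  · simp
  · rw [← pow_add, ← two_mul, pow_mul]; norm_num

/-- The orientation of a separated configuration is a sign. -/
theorem s_cases {s : ℝ} (hsep : (s = 1 ∧ ∀ i l, z i < ν l) ∨ (s = -1 ∧ ∀ i l, ν l < z i)) : s = 1 ∨ s = -1 := by
  rcases hsep with ⟨h, _⟩ | ⟨h, _⟩
  · exact Or.inl h
  · exact Or.inr h

/-- A power of a sign is a sign. -/
theorem pow_sign_cases {s : ℝ} (hs : s = 1 ∨ s = -1) (n : ℕ) : s ^ n = 1 ∨ s ^ n = -1 := by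
  rcases hs with rfl | rfl
  · exact Or.inl (one_pow n)
  · exact neg_one_pow_eq_or ℝ n

/-- `η = ±1`. -/
theorem ηnew_cases (hθ : d.θ = 1 ∨ d.θ = -1) (hs : s = 1 ∨ s = -1) : ηnew s d = 1 ∨ ηnew s d = -1 := by
  unfold ηnew
  rcases pow_sign_cases hs (k + 1) with h1 | h1 <;> rcases neg_one_pow_eq_or ℝ k with h2 | h2 <;>
    rcases hθ with h3 | h3 <;> norm_num [h1, h2, h3]

/-- `η² = 1`. -/
theorem ηnew_sq (hθ : d.θ = 1 ∨ d.θ = -1) (hs : s = 1 ∨ s = -1) : ηnew s d * ηnew s d = 1 := by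
  rcases ηnew_cases s d hθ hs with h | h <;> rw [h] <;> norm_num

/-- `θ_new = ±1`. -/
theorem θnew_cases (hθ : d.θ = 1 ∨ d.θ = -1) (hs : s = 1 ∨ s = -1) : θnew s d = 1 ∨ θnew s d = -1 := by
  unfold θnew
  rcases hs with h1 | h1 <;> rcases neg_one_pow_eq_or ℝ k with h2 | h2 <;> rcases hθ with h3 | h3 <;> norm_num [h1, h2, h3]

/-- The radicand of `c_l` is positive: `0 < −η·r_l·β_l` (uses the alternation of the child and the orientation). -/
theorem radicand_pos (halt : ∀ l : Fin k, 0 < d.θ * (-1) ^ (l : ℕ) * d.β l) (hν : StrictMono ν)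
    (hsep : (s = 1 ∧ ∀ i l, z i < ν l) ∨ (s = -1 ∧ ∀ i l, ν l < z i)) (l : Fin k) :
    0 < -(ηnew s d * rcoef ν z l * d.β l) := by
  have h1 := halt l
  have h2 := eval_Nlpoly_root_sign ν hν l
  have h3 := eval_Ppoly_child_root_sign ν z hsep l
  have hl : (l : ℕ) + 1 ≤ k := l.isLt
  have hpow : -((-1 : ℝ) ^ k) = (-1) ^ (l : ℕ) * (-1) ^ (k - 1 - (l : ℕ)) := by
    rw [← pow_add]
    obtain ⟨j, hj⟩ : ∃ j, k = j + 1 := ⟨k - 1, by omega⟩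
    subst hj
    have : (l : ℕ) + (j + 1 - 1 - (l : ℕ)) = j := by omega
    rw [this, pow_succ]; ring
  have hsq : ((-1 : ℝ) ^ (k - 1 - (l : ℕ))) * (-1) ^ (k - 1 - (l : ℕ)) = 1 := by
    rw [← pow_add, ← two_mul, pow_mul]; norm_num
  have hsign : -((-1 : ℝ) ^ k) * (-1) ^ (k - 1 - (l : ℕ)) = (-1) ^ (l : ℕ) := by
    calc -((-1 : ℝ) ^ k) * (-1) ^ (k - 1 - (l : ℕ))
        = (-1) ^ (l : ℕ) * ((-1) ^ (k - 1 - (l : ℕ)) * (-1) ^ (k - 1 - (l : ℕ))) := by rw [hpow]; ring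
      _ = (-1) ^ (l : ℕ) := by rw [hsq, mul_one]
  set a := d.θ * (-1) ^ (l : ℕ) * d.β l with ha
  set b := (-1) ^ (k - 1 - (l : ℕ)) * (Nlpoly ν l).eval (ν l) with hb
  set p := s ^ (k + 1) * (Ppoly z).eval (ν l) with hp
  have hNl : (Nlpoly ν l).eval (ν l) ≠ 0 := eval_Nlpoly_root_ne_zero ν hν l
  have hmain : -(ηnew s d * rcoef ν z l * d.β l) * b = a * p := by
    have e1 : -(ηnew s d * rcoef ν z l * d.β l) * b
        = (-((-1 : ℝ) ^ k) * (-1) ^ (k - 1 - (l : ℕ))) * (s ^ (k + 1) * d.θ * d.β l) *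
            ((Ppoly z).eval (ν l) / (Nlpoly ν l).eval (ν l) * (Nlpoly ν l).eval (ν l)) := by
      rw [hb]; unfold ηnew rcoef; ring
    rw [e1, div_mul_cancel₀ _ hNl, hsign, ha, hp]
    ring
  have hbpos : 0 < b := h2
  have key : -(ηnew s d * rcoef ν z l * d.β l) = a * p / b := by
    rw [eq_div_iff (ne_of_gt hbpos), hmain]
  rw [key]
  positivity

/-- `c_l² = −η r_l β_l`. -/
theorem cvec_sq (halt : ∀ l : Fin k, 0 < d.θ * (-1) ^ (l : ℕ) * d.β l) (hν : StrictMono ν)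
    (hsep : (s = 1 ∧ ∀ i l, z i < ν l) ∨ (s = -1 ∧ ∀ i l, ν l < z i)) (l : Fin k) :
    cvec ν z s d l ^ 2 = -(ηnew s d * rcoef ν z l * d.β l) := by
  unfold cvec
  rw [Real.sq_sqrt (radicand_pos ν z s d halt hν hsep l).le]

/-- An alternating sign characteristic has no zero entry. -/
theorem β_ne_zero (halt : ∀ l : Fin k, 0 < d.θ * (-1) ^ (l : ℕ) * d.β l) (l : Fin k) : d.β l ≠ 0 := by
  intro h; have := halt l; rw [h, mul_zero] at this; exact lt_irrefl _ this

/-- `c_l² / β_l = −η r_l`. -/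
theorem cvec_sq_div (halt : ∀ l : Fin k, 0 < d.θ * (-1) ^ (l : ℕ) * d.β l) (hν : StrictMono ν)
    (hsep : (s = 1 ∧ ∀ i l, z i < ν l) ∨ (s = -1 ∧ ∀ i l, ν l < z i)) (l : Fin k) :
    cvec ν z s d l ^ 2 / d.β l = -(ηnew s d * rcoef ν z l) := by
  rw [cvec_sq ν z s d halt hν hsep l]
  field_simp [β_ne_zero d halt l]

/-- **The secular identity**: `ψ(x) · N(x) = η · P(x)` off the child's roots. -/
theorem ψfun_mul_Npoly (halt : ∀ l : Fin k, 0 < d.θ * (-1) ^ (l : ℕ) * d.β l) (hν : StrictMono ν)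
    (hν5 : ∀ l, ν l < 5) (hsep : (s = 1 ∧ ∀ i l, z i < ν l) ∨ (s = -1 ∧ ∀ i l, ν l < z i))
    {x : ℝ} (hx : ∀ l, x ≠ ν l) :
    ψfun ν z s d x * (Npoly ν).eval x = ηnew s d * (Ppoly z).eval x := by
  have hterm : ∀ l : Fin k,
      cvec ν z s d l ^ 2 / d.β l / (x - ν l) * (Npoly ν).eval x
        = -(ηnew s d * rcoef ν z l) * (Nlpoly ν l).eval x := by
    intro l
    rw [eval_Npoly_eq_mul ν l x, ← cvec_sq_div ν z s d halt hν hsep l]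
    have : x - ν l ≠ 0 := sub_ne_zero.mpr (hx l)
    field_simp
  unfold ψfun
  rw [eval_Ppoly_eq ν z hν hν5 x, sub_mul, Finset.sum_mul]
  simp_rw [hterm]
  rw [mul_add, Finset.mul_sum]
  have : ∑ l, -(ηnew s d * rcoef ν z l) * (Nlpoly ν l).eval x
      = -∑ l, ηnew s d * (rcoef ν z l * (Nlpoly ν l).eval x) := by
    rw [← Finset.sum_neg_distrib]
    exact Finset.sum_congr rfl fun l _ => by ring
  rw [this]
  ring

/-- `ψ` vanishes at every parent root `z_i`. -/
theorem ψfun_root (halt : ∀ l : Fin k, 0 < d.θ * (-1) ^ (l : ℕ) * d.β l) (hν : StrictMono ν)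
    (hν5 : ∀ l, ν l < 5) (hsep : (s = 1 ∧ ∀ i l, z i < ν l) ∨ (s = -1 ∧ ∀ i l, ν l < z i))
    (i : Fin (k + 1)) : ψfun ν z s d (z i) = 0 := by
  have h := ψfun_mul_Npoly ν z s d halt hν hν5 hsep (x := z i) fun l => z_ne_ν ν z hsep i l
  rw [eval_Ppoly_root, mul_zero] at h
  exact (mul_eq_zero.mp h).resolve_right (eval_Npoly_parent_root_ne_zero ν z hsep i)

/-- The secular function is differentiable off the child roots, with derivative `ψder`. -/
theorem hasDerivAt_ψfun {x : ℝ} (hx : ∀ l, x ≠ ν l) : HasDerivAt (ψfun ν z s d) (ψder ν z s d x) x := by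
  have hL : HasDerivAt (fun y => ηnew s d * (Lpoly ν z).eval y) (ηnew s d * lslope ν z) x := by
    have : (fun y => ηnew s d * (Lpoly ν z).eval y) = fun y => ηnew s d * (lconst ν z + lslope ν z * y) := by
      funext y; rw [eval_Lpoly]
    rw [this]
    have h1 : HasDerivAt (fun y => lconst ν z + lslope ν z * y) (lslope ν z) x := by
      simpa using ((hasDerivAt_id x).const_mul (lslope ν z)).const_add (lconst ν z)
    exact h1.const_mul (ηnew s d)
  have hS : HasDerivAt (fun y => ∑ l, cvec ν z s d l ^ 2 / d.β l / (y - ν l))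
      (∑ l, -(cvec ν z s d l ^ 2 / d.β l / (x - ν l) ^ 2)) x := by
    refine HasDerivAt.fun_sum fun l _ => ?_
    have hne : x - ν l ≠ 0 := sub_ne_zero.mpr (hx l)
    have h1 : HasDerivAt (fun y => y - ν l) 1 x := (hasDerivAt_id x).sub_const _
    have h2 := (hasDerivAt_const x (cvec ν z s d l ^ 2 / d.β l)).div h1 hne
    have hval : (0 * (x - ν l) - cvec ν z s d l ^ 2 / d.β l * 1) / (x - ν l) ^ 2
        = -(cvec ν z s d l ^ 2 / d.β l / (x - ν l) ^ 2) := by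
      rw [zero_mul, zero_sub, mul_one, neg_div]
    rw [hval] at h2
    exact h2
  have hval : ψder ν z s d x = ηnew s d * lslope ν z - ∑ l, -(cvec ν z s d l ^ 2 / d.β l / (x - ν l) ^ 2) := by
    unfold ψder
    rw [Finset.sum_neg_distrib, sub_neg_eq_add]
  rw [hval]
  exact hL.sub hS

/-- The complement of the child roots is open. -/
theorem isOpen_nonroot : IsOpen {x : ℝ | ∀ l : Fin k, x ≠ ν l} := by
  have : {x : ℝ | ∀ l : Fin k, x ≠ ν l} = ⋂ l : Fin k, {ν l}ᶜ := by
    ext x; simp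
  rw [this]
  exact isOpen_iInter_of_finite fun l => isOpen_compl_singleton

/-- **`βnew i · N(z_i) = η · P'(z_i)`** — differentiate the secular identity at the parent root `z_i`. -/
theorem βnew_mul_Npoly (halt : ∀ l : Fin k, 0 < d.θ * (-1) ^ (l : ℕ) * d.β l) (hν : StrictMono ν)
    (hν5 : ∀ l, ν l < 5) (hsep : (s = 1 ∧ ∀ i l, z i < ν l) ∨ (s = -1 ∧ ∀ i l, ν l < z i))
    (i : Fin (k + 1)) :
    βnew ν z s d i * (Npoly ν).eval (z i)
      = ηnew s d * (Polynomial.derivative (Ppoly z)).eval (z i) := by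
  have hzν : ∀ l, z i ≠ ν l := fun l => z_ne_ν ν z hsep i l
  have hψ : HasDerivAt (ψfun ν z s d) (ψder ν z s d (z i)) (z i) := hasDerivAt_ψfun ν z s d hzν
  have hN : HasDerivAt (fun y => (Npoly ν).eval y) ((Polynomial.derivative (Npoly ν)).eval (z i)) (z i) :=
    Polynomial.hasDerivAt _ _
  have hprod := hψ.mul hN
  have hP : HasDerivAt (fun y => ηnew s d * (Ppoly z).eval y)
      (ηnew s d * (Polynomial.derivative (Ppoly z)).eval (z i)) (z i) :=
    (Polynomial.hasDerivAt _ _).const_mul _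
  have heq : (fun y => ψfun ν z s d y * (Npoly ν).eval y) =ᶠ[nhds (z i)] fun y => ηnew s d * (Ppoly z).eval y := by
    filter_upwards [(isOpen_nonroot ν).mem_nhds (show z i ∈ {x : ℝ | ∀ l : Fin k, x ≠ ν l} from hzν)] with y hy
    exact ψfun_mul_Npoly ν z s d halt hν hν5 hsep hy
  have h2 := (hprod.congr_of_eventuallyEq heq.symm).unique hP
  rw [ψfun_root ν z s d halt hν hν5 hsep i, zero_mul, add_zero] at h2
  unfold βnew
  exact h2

/-- `P'(z_i) = ∏_{j ≠ i} (z_i − z_j)`. -/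
theorem eval_derivative_Ppoly (i : Fin (k + 1)) :
    (Polynomial.derivative (Ppoly z)).eval (z i) = ∏ j ∈ univ.erase i, (z i - z j) := by
  classical
  unfold Ppoly
  rw [Polynomial.derivative_prod_finset, Polynomial.eval_finsetSum, Finset.sum_eq_single i]
  · simp [Polynomial.eval_prod]
  · intro j _ hj
    rw [Polynomial.eval_mul, Polynomial.eval_prod]
    have : ∏ l ∈ univ.erase j, (X - C (z l)).eval (z i) = 0 :=
      Finset.prod_eq_zero (Finset.mem_erase.mpr ⟨fun h => hj (h ▸ rfl) |>.elim, mem_univ i⟩) (by simp)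
    rw [this, zero_mul]
  · intro h; exact absurd (mem_univ i) h

/-- `P'(z_i)` has sign `(−1)^{k−i}` for increasing `z`. -/
theorem eval_derivative_Ppoly_sign (hz : StrictMono z) (i : Fin (k + 1)) :
    0 < (-1) ^ (k - (i : ℕ)) * (Polynomial.derivative (Ppoly z)).eval (z i) := by
  rw [eval_derivative_Ppoly]
  have := prod_erase_sub_sign _ hz i
  simpa using this

/-- **Alternation is inherited**: `0 < θ_new · (−1)^i · βnew i` with `θ_new = s (−1)^k θ`. -/
theorem βnew_alt (halt : ∀ l : Fin k, 0 < d.θ * (-1) ^ (l : ℕ) * d.β l) (hθ : d.θ = 1 ∨ d.θ = -1)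
    (hν : StrictMono ν) (hz : StrictMono z) (hν5 : ∀ l, ν l < 5)
    (hsep : (s = 1 ∧ ∀ i l, z i < ν l) ∨ (s = -1 ∧ ∀ i l, ν l < z i)) (i : Fin (k + 1)) :
    0 < θnew s d * (-1) ^ (i : ℕ) * βnew ν z s d i := by
  have hkey := βnew_mul_Npoly ν z s d halt hν hν5 hsep i
  have hN := eval_Npoly_parent_root_sign ν z hsep i
  have hP := eval_derivative_Ppoly_sign z hz i
  have hs := s_cases ν z hsep
  have hss := sq_pow_eq_one hs (k + 1)
  have hθθ : d.θ * d.θ = 1 := by rcases hθ with h | h <;> rw [h] <;> norm_num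
  have hi : (i : ℕ) ≤ k := Nat.lt_succ_iff.mp i.isLt
  set P' := (Polynomial.derivative (Ppoly z)).eval (z i) with hP'
  set N := (Npoly ν).eval (z i) with hNdef
  have hpow : ((-1 : ℝ) ^ (i : ℕ)) * (-1) ^ k = (-1) ^ (k - (i : ℕ)) := by
    rw [← pow_add]
    have : (i : ℕ) + k = (k - (i : ℕ)) + 2 * (i : ℕ) := by omega
    rw [this, pow_add, pow_mul]; norm_num
  have h1 : (θnew s d * (-1) ^ (i : ℕ) * βnew ν z s d i) * ((-1) ^ k * s ^ k * N) = (-1) ^ (k - (i : ℕ)) * P' := by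
    have e1 : (θnew s d * (-1) ^ (i : ℕ) * βnew ν z s d i) * ((-1) ^ k * s ^ k * N)
        = s * s ^ k * d.θ * ((-1) ^ k * (-1) ^ k) * (-1) ^ (i : ℕ) * (βnew ν z s d i * N) := by
      unfold θnew; ring
    rw [e1, hkey]
    unfold ηnew
    have e2 : s * s ^ k * d.θ * ((-1) ^ k * (-1) ^ k) * (-1) ^ (i : ℕ) * (s ^ (k + 1) * (-1) ^ k * d.θ * P')
        = (s ^ (k + 1) * s ^ (k + 1)) * (d.θ * d.θ) * ((-1) ^ k * (-1) ^ k) * ((-1) ^ (i : ℕ) * (-1) ^ k) * P' := by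
      ring
    have hkk : ((-1 : ℝ) ^ k) * (-1) ^ k = 1 := by rw [← pow_add, ← two_mul, pow_mul]; norm_num
    rw [e2, hss, hθθ, hkk, hpow]; ring
  by_contra hcon
  have hcon' : θnew s d * (-1) ^ (i : ℕ) * βnew ν z s d i ≤ 0 := not_lt.mp hcon
  have h2 := mul_nonpos_of_nonpos_of_nonneg hcon' hN.le
  rw [h1] at h2
  exact absurd hP (not_lt.mpr h2)

end Secular

end Gen

end Summit.ValiantsHypothesis.ValiantsHypothesis.Theorems.LacunarySymmetroidMatrixDescartes.Census.LagrangeTower
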